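import Summits.ABC.ABC.Theses.DefiniteXi
import Summits.ABC.ABC.Theorems.EisensteinQuarantine.Negative.EisensteinQuarantineFalseOfProthDepthFamily
import Summits.ABC.ABC.Theorems.DefiniteXiEisensteinQuarantineThreeAdicCalibration
import Summits.ABC.ABC.Theorems.XiBound.Negative.XiBoundDomainSetup
import Summits.ABC.ABC.Theorems.DefiniteXiEisensteinQuarantineFreyEigenLinePrime
import Literature.NumberTheory.Sieve.PrimesInAPTwoPowerModuli
import HarnessLib

/-!
# `EisensteinQuarantine` (stmt-ABC-15023, route ABC/DefiniteXi) is false under the forced-pair occurrence,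
# multiplicity one and modularity — the line `forced-pair-dlog` closed modulo its research stub

Negative lemma filed `--negative-modulo ForcedPairOccurrence` by the lead of crux line `forced-pair-dlog`
(2026-08-17).  The line (skeleton `Cruxes/EisensteinQuarantine/Lines/forced_pair_dlog.lean`, rev 2) constructs the
hypothesis `H = ProthDepthFamily` of the landed kill `EisensteinQuarantine_false_of_ProthDepthFamily` (p107816) from
three stubs.  Their status after cycle 1:

* `stub_twoPowerPrimeSupply` — the two-prime 2-power supply (`2^s ∣ q − 1`, `2^s q ∣ ℓ − 1`, `ℓ ≤ 2^{As}`):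
  PROVED UNCONDITIONALLY (Literature theorem
  `Literature.NumberTheory.Sieve.PrimesInAPGallagher.exists_primes_two_pow_mul_dvd_sub_one`, p132885: Gallagher's prime
  number theorem off one exceptional modulus + Page + no primitive quadratic character of conductor `2^k`, `k ≥ 4`;
  no Deuring–Heilbronn);
* `stub_freyEigenLinePrime` — the Frey eigen-line at a prime quarantine of a squarefree conductor is a line:
  REDUCED (p132391, `freyEigenLinePrime_of_rankOne_of_freyModularity`) to the two EXISTING named facts
  `Literature.NumberTheory.EllipticCurves.takahashi2001_brandtEigenLattice_rank_one` (Jacquet–Langlands/Eichler +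
  strong multiplicity one; Takahashi 2001 §2) and `Summit.ABC.ABC.Theses.DefiniteXi.FreyModularity` (route item;
  = modularity, `nonempty_modularParametrizationData`), displayed below as hypotheses;
* `stub_forcedPairOccurrence` — THE MECHANISM, a research statement not in print (Mazur's level-`q` 2-Eisenstein
  tower raised through the quarantined `ℓ ≡ 1 (mod q)`): the hypothesis `ForcedPairOccurrence` of this file
  (verbatim the registered stub; equivalent to `∃ c, v₂ ξ(E_(−ℓ,ℓ−1); N/ℓ, ℓ) ≥ v₂(q−1) − c` by the landed
  `stub_forcedPairOccurrence_of_dvd_xi` / dictionary p96490).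

So: `takahashi2001_brandtEigenLattice_rank_one → FreyModularity → ForcedPairOccurrence → ¬ EisensteinQuarantine`
(`EisensteinQuarantine_false_of_ForcedPairOccurrence`), the prime supply being a theorem.  Compared with the tree's
`EisensteinQuarantine_false_of_ProthDepthLaw` (p107816: Linnik for every modulus displayed + the uniform Proth law,
the latter census-false at `p = 786433`), the analytic input is discharged and the arithmetic input is the forced-pair
law, consistent with every census row (TRIAGE-r2-1/2).

## References

* [Mazur1977] B. Mazur, *Modular curves and the Eisenstein ideal*, Publ. Math. IHÉS 47 (1977).
* [Takahashi2001] S. Takahashi, J. Number Theory 90 (2001), §2 p. 78.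
* [Gallagher1970] P. X. Gallagher, Invent. Math. 11 (1970), Theorem 7.
-/

-- `Summit.<Summit>.<Problem>`: for the single-conjunct summit `ABC` the duplicate `ABC.ABC` is mandated.
set_option linter.dupNamespace false

noncomputable section

open scoped BigOperators
open Literature.NumberTheory.Automorphic Literature.NumberTheory.EllipticCurves

namespace Summit.ABC.ABC.Theorems.EisensteinQuarantine.Negative

/-! ## The research hypothesis -/

/-- **Hypothesis `ForcedPairOccurrence` — the forced-pair occurrence (research statement, NOT proved, NOT in
print; verbatim the registered stub `stub_forcedPairOccurrence` of line `forced-pair-dlog`).**  There is `c` such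
that for all primes `q ≠ 2` and `ℓ` with `32 q ∣ ℓ − 1` (so `ℓ ≡ 1 (mod q)`: the pair is FORCED, Mazur's
discrete-log invariant `log_q ℓ` vanishes to all 2-adic depths), for the Frey curve `E = E_(−ℓ, ℓ−1)` of the
triple `1 + (ℓ−1) = ℓ` (conductor `N = rad(ℓ(ℓ−1))`), every Brandt setup `S` of type `(N/ℓ, ℓ)` and every
generator `φ` of the `a(E)`-eigen-line, some `ψ` in the `w`-orthogonal complement of `φ` satisfies
`φ ≡ ψ (mod 2^{v₂(q−1) − c})`.  Equivalently (landed `stub_forcedPairOccurrence_of_dvd_xi`, dictionary p96490):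
`v₂ ξ_S(E; N/ℓ, ℓ) ≥ v₂(q−1) − c'`.  Candidate mechanism: Mazur's level-`q` 2-Eisenstein tower (index
`num((q−1)/12)`) level-raised through `ℓ` into the `ℓ`-new definite space (Mazur 1977 II.16.6/II.18.10 for the
level-`q` tower; nothing in print at composite level and `p = 2`).  HYPOTHESIS of this negative lemma (filed
`--negative-modulo ForcedPairOccurrence`); not a Literature fact. -/
def ForcedPairOccurrence : Prop :=
  ∃ c : ℕ, ∀ q ℓ : ℕ, q.Prime → ℓ.Prime → q ≠ 2 → 32 * q ∣ ℓ - 1 →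
    ∀ N : ℕ, (freyCurve (-(ℓ : ℤ)) ((ℓ - 1 : ℕ) : ℤ)).conductorNorm ℤ = N →
    ∀ (S : Brandt.XiSetup (N / ℓ) ℓ) [Fintype (Brandt.ClassSet S.O)],
      ∀ φ : Brandt.ClassSet S.O → ℤ, φ ≠ 0 →
        Brandt.eigenLattice (N / ℓ * ℓ) (Brandt.matrix S.O)
            (fun n => (freyCurve (-(ℓ : ℤ)) ((ℓ - 1 : ℕ) : ℤ)).LFunction n) = ℤ ∙ φ →
        ∃ ψ : Brandt.ClassSet S.O → ℤ,
          ∑ i, (Brandt.weight S.O i : ℤ) * ψ i * φ i = 0 ∧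
            ∀ i, ((2 ^ ((q - 1).factorization 2 - c) : ℕ) : ℤ) ∣ φ i - ψ i

/-! ## The reduction -/

/-- **Eigen-line + forced-pair occurrence ⟹ the forced-pair depth law**: for primes `q ≠ 2`, `ℓ` with
`32 q ∣ ℓ − 1` and `N` the conductor of `E_(−ℓ,ℓ−1)`, `2^{v₂(q−1)} ≤ 2^c · ordProj[2] ξ(E; N/ℓ, ℓ)`.  The family
lies in the crux's domain with `Nm = ℓ` (`N = rad(ℓ(ℓ−1))` by the tree's Serre normalisation
`conductorNorm_freyCurve_serre`, squarefree, `ℓ ∣ N`), a setup exists (`nonempty_xiSetup_freyCurve`) and computes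
`ξ` (`Brandt.XiSetup.brandtXi_eq_xi`); `hR` gives the generator `φ`, the occurrence the witness `ψ`, and the landed
`pow_le_ordProj_xi_of_occurrence` (p97646) the depth.  (Glue of the line skeleton, verbatim.) [cite: Mazur1977, II.16.6 and II.18.10] -/
theorem forcedPairDepthLaw_of_occurrence
    (hR : ∀ a b : ℤ, IsCoprime a b → a * b * (a + b) ≠ 0 →
      ∀ (N : ℕ) [NeZero N], (freyCurve a b).conductorNorm ℤ = N → Squarefree N →
      ∀ ℓ : ℕ, ℓ.Prime → ℓ ∣ N →
      ∀ (S : Brandt.XiSetup (N / ℓ) ℓ) [Fintype (Brandt.ClassSet S.O)],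
        ∃ φ : Brandt.ClassSet S.O → ℤ, φ ≠ 0 ∧
          Brandt.eigenLattice (N / ℓ * ℓ) (Brandt.matrix S.O)
            (fun n => (freyCurve a b).LFunction n) = ℤ ∙ φ)
    (hO : ForcedPairOccurrence) :
    ∃ c : ℕ, ∀ q ℓ : ℕ, q.Prime → ℓ.Prime → q ≠ 2 → 32 * q ∣ ℓ - 1 →
      ∀ N : ℕ, (freyCurve (-(ℓ : ℤ)) ((ℓ - 1 : ℕ) : ℤ)).conductorNorm ℤ = N →
        2 ^ ((q - 1).factorization 2) ≤
          2 ^ c * ordProj[2] (brandtXi (N / ℓ) ℓ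
            (fun n => (freyCurve (-(ℓ : ℤ)) ((ℓ - 1 : ℕ) : ℤ)).LFunction n)) := by
  obtain ⟨c, hc⟩ := hO
  refine ⟨c, fun q ℓ hq hℓ hq2 h32 N hN => ?_⟩
  -- the Frey data `(a, b) = (−ℓ, ℓ−1)` lie in the crux's domain with `Nm = ℓ`
  have hℓ1 : 1 ≤ ℓ := hℓ.one_lt.le
  have hM0 : ℓ - 1 ≠ 0 := by have := hℓ.two_le; omega
  have h32' : (32 : ℕ) ∣ ℓ - 1 := (Dvd.intro q rfl).trans h32
  have hℓ2 : ℓ ≠ 2 := by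
    intro h
    rw [h] at h32'
    norm_num at h32'
  set a : ℤ := -(ℓ : ℤ) with ha
  set b : ℤ := ((ℓ - 1 : ℕ) : ℤ) with hb
  have hℓcast : (ℓ : ℤ) = ((ℓ - 1 : ℕ) : ℤ) + 1 := by
    rw [Nat.cast_sub hℓ1]; push_cast; ring
  have hab_sum : a + b = -1 := by rw [ha, hb, hℓcast]; ring
  have habc : a * b * (a + b) = ((ℓ * (ℓ - 1) : ℕ) : ℤ) := by
    rw [hab_sum, ha, hb]; push_cast; ring
  have hPM0 : ℓ * (ℓ - 1) ≠ 0 := Nat.mul_ne_zero hℓ.ne_zero hM0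
  have h0 : a * b * (a + b) ≠ 0 := by rw [habc]; exact_mod_cast hPM0
  have hab : IsCoprime a b := by
    rw [ha, hb, IsCoprime.neg_left_iff, Int.isCoprime_iff_gcd_eq_one, Int.gcd_natCast_natCast]
    exact (Nat.coprime_self_sub_right hℓ1).mpr (Nat.coprime_one_right ℓ)
  have ha4 : a ≡ -1 [ZMOD 4] := by
    have h4M : (4 : ℕ) ∣ ℓ - 1 := (show (4 : ℕ) ∣ 32 by norm_num).trans h32'
    have h4 : (4 : ℤ) ∣ b := by rw [hb]; exact_mod_cast h4M
    have : a = -1 - b := by rw [ha, hb, hℓcast]; ring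
    rw [this]
    calc -1 - b ≡ -1 - 0 [ZMOD 4] := Int.ModEq.sub_left _ ((Int.modEq_zero_iff_dvd).mpr h4)
      _ = -1 := by ring
  have hb32 : (32 : ℤ) ∣ b := by rw [hb]; exact_mod_cast h32'
  have hnatAbs : (a * b * (a + b)).natAbs = ℓ * (ℓ - 1) := by rw [habc, Int.natAbs_natCast]
  haveI : (freyCurve a b).IsElliptic := isElliptic_freyCurve h0
  have hNval : N = UniqueFactorizationMonoid.radical (ℓ * (ℓ - 1)) := by
    rw [← hN, conductorNorm_freyCurve_serre hab h0 ha4 hb32, hnatAbs]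
  have hNpos : 0 < N := by rw [hNval]; exact Nat.radical_pos _
  haveI : NeZero N := ⟨hNpos.ne'⟩
  have hNsq : Squarefree N := by rw [hNval]; exact UniqueFactorizationMonoid.squarefree_radical
  have hℓN : ℓ ∣ N := by
    rw [hNval]
    refine Nat.dvd_of_mem_primeFactors ?_
    rw [Nat.primeFactors_radical, Nat.primeFactors_mul hℓ.ne_zero hM0, hℓ.primeFactors]
    simp
  have hodd : Odd ℓ := hℓ.odd_of_ne_two hℓ2
  have hcard : Odd ℓ.primeFactors.card := by rw [hℓ.primeFactors]; simp
  -- a Brandt setup of type `(N/ℓ, ℓ)` exists and computes `ξ`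
  have hne := Summit.ABC.ABC.Theorems.XiBound.Negative.nonempty_xiSetup_freyCurve
    hab h0 hodd hℓ.squarefree hcard (by rw [hN]; exact hℓN)
  rw [hN] at hne
  obtain ⟨S⟩ := hne
  letI : Fintype (Brandt.ClassSet S.O) := Fintype.ofFinite _
  rw [S.brandtXi_eq_xi]
  -- stub 2: the eigen-line; stub 3: the occurrence witness; landed dictionary: the depth
  obtain ⟨φ, hφ, hL⟩ := hR a b hab h0 N hN hNsq ℓ hℓ hℓN S
  obtain ⟨ψ, hψ, hcong⟩ := hc q ℓ hq hℓ hq2 h32 N hN S φ hφ hL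
  have hle := Summit.ABC.ABC.Theorems.pow_le_ordProj_xi_of_occurrence Nat.prime_two S _ hφ hL
    ((q - 1).factorization 2 - c) hψ hcong
  calc 2 ^ ((q - 1).factorization 2)
      ≤ 2 ^ (c + ((q - 1).factorization 2 - c)) := Nat.pow_le_pow_right (by norm_num) (by omega)
    _ = 2 ^ c * 2 ^ ((q - 1).factorization 2 - c) := pow_add _ _ _
    _ ≤ 2 ^ c * ordProj[2] (S.xi fun n => (freyCurve a b).LFunction n) := Nat.mul_le_mul_left _ hle


/-- **Two-prime supply + the forced-pair depth law ⟹ `ProthDepthFamily`**: given `s₀` put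
`s := max s₀ (max s₁ 5)`; the supply gives primes `q`, `ℓ` with `2^s ∣ q − 1` (so `q ≠ 2`), `2^s q ∣ ℓ − 1`,
`ℓ ≤ 2^{As}`; then `2^s ∣ ℓ − 1`, `32 q ∣ ℓ − 1`, and the law gives `2^s ≤ 2^{v₂(q−1)} ≤ 2^c · ordProj[2] ξ`.
(Glue of the line skeleton, verbatim.) [cite: Gallagher1970, Theorem 7] -/
theorem prothDepthFamily_of_forcedPairDepthLaw
    (hSup : ∃ A s₁ : ℕ, ∀ s : ℕ, s₁ ≤ s →
      ∃ q ℓ : ℕ, q.Prime ∧ ℓ.Prime ∧ 2 ^ s ∣ q - 1 ∧ 2 ^ s * q ∣ ℓ - 1 ∧ ℓ ≤ 2 ^ (A * s))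
    (hF : ∃ c : ℕ, ∀ q ℓ : ℕ, q.Prime → ℓ.Prime → q ≠ 2 → 32 * q ∣ ℓ - 1 →
      ∀ N : ℕ, (freyCurve (-(ℓ : ℤ)) ((ℓ - 1 : ℕ) : ℤ)).conductorNorm ℤ = N →
        2 ^ ((q - 1).factorization 2) ≤
          2 ^ c * ordProj[2] (brandtXi (N / ℓ) ℓ
            (fun n => (freyCurve (-(ℓ : ℤ)) ((ℓ - 1 : ℕ) : ℤ)).LFunction n))) :
    ProthDepthFamily := by
  obtain ⟨A, s₁, hAs⟩ := hSup
  obtain ⟨c, hc⟩ := hF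
  refine ⟨c, A, fun s₀ => ?_⟩
  set s : ℕ := max s₀ (max s₁ 5) with hs
  have hs5 : 5 ≤ s := (le_max_right _ _).trans (le_max_right _ _)
  have hs₁ : s₁ ≤ s := (le_max_left _ _).trans (le_max_right _ _)
  have h32s : (32 : ℕ) ∣ 2 ^ s := by
    rw [show (32 : ℕ) = 2 ^ 5 by norm_num]; exact Nat.pow_dvd_pow 2 hs5
  -- the unquarantined partner `q ≡ 1 (mod 2^s)` and the quarantined prime `ℓ ≡ 1 (mod 2^s q)`
  obtain ⟨q, ℓ, hq, hℓ, hsq, hsl, hℓA⟩ := hAs s hs₁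
  have hq2 : q ≠ 2 := by
    intro h
    rw [h] at hsq
    have := Nat.le_of_dvd (by norm_num) (h32s.trans hsq)
    omega
  have h2sl : 2 ^ s ∣ ℓ - 1 := (Dvd.intro q rfl).trans hsl
  have h32q : 32 * q ∣ ℓ - 1 := (Nat.mul_dvd_mul_right h32s q).trans hsl
  refine ⟨s, ℓ, le_max_left _ _, hℓ, h2sl, hℓA, fun N hN => ?_⟩
  -- depth: `2^s ≤ 2^{v₂(q−1)} ≤ 2^c · ordProj[2] ξ`
  have h := hc q ℓ hq hℓ hq2 h32q N hN
  have hqm1 : q - 1 ≠ 0 := by have := hq.two_le; omega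
  have hsv : s ≤ (q - 1).factorization 2 :=
    (Nat.prime_two.pow_dvd_iff_le_factorization hqm1).mp hsq
  exact (Nat.pow_le_pow_right (by norm_num) hsv).trans h


/-- **Multiplicity one + modularity + the forced-pair occurrence ⟹ `ProthDepthFamily`** (the hypothesis `H` of
the landed `EisensteinQuarantine_false_of_ProthDepthFamily`, p107816): the eigen-line comes from the two named
facts (landed `freyEigenLinePrime_of_rankOne_of_freyModularity`, p132391), the occurrence is the hypothesis, the
prime supply is the Literature theorem `exists_primes_two_pow_mul_dvd_sub_one` (p132885). [cite: Takahashi2001, §2 p. 78] -/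
theorem prothDepthFamily_of_forcedPairOccurrence
    (hR : Literature.NumberTheory.EllipticCurves.takahashi2001_brandtEigenLattice_rank_one)
    (hM : Summit.ABC.ABC.Theses.DefiniteXi.FreyModularity) (hO : ForcedPairOccurrence) :
    ProthDepthFamily :=
  prothDepthFamily_of_forcedPairDepthLaw
    Literature.NumberTheory.Sieve.PrimesInAPGallagher.exists_primes_two_pow_mul_dvd_sub_one
    (forcedPairDepthLaw_of_occurrence
      (Summit.ABC.ABC.Theorems.freyEigenLinePrime_of_rankOne_of_freyModularity hR hM) hO)

/-- **`EisensteinQuarantine` is false under multiplicity one, modularity and the forced-pair occurrence** —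
the line `forced-pair-dlog` closed modulo its research stub: the two displayed named facts are theorems in print
(Jacquet–Langlands/Eichler + strong multiplicity one; Wiles/BCDT), the prime supply is a theorem of the tree, and
`ForcedPairOccurrence` is the one arithmetic input nobody has proved. Via p107816. [cite: Mazur1977, II.16.6 and II.18.10] -/
theorem EisensteinQuarantine_false_of_ForcedPairOccurrence
    (hR : Literature.NumberTheory.EllipticCurves.takahashi2001_brandtEigenLattice_rank_one)
    (hM : Summit.ABC.ABC.Theses.DefiniteXi.FreyModularity) (hO : ForcedPairOccurrence) :
    ¬ Summit.ABC.ABC.Theses.DefiniteXi.EisensteinQuarantine :=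
  EisensteinQuarantine_false_of_ProthDepthFamily (prothDepthFamily_of_forcedPairOccurrence hR hM hO)

/-! ## Corollary: the uniform Proth law refutes the crux with NO analytic hypothesis -/

/-- **Uniform Proth law ⟹ `ProthDepthFamily`, unconditionally in the prime supply.**  The tree's
`prothDepthFamily_of_prothDepthLaw` (p107816) displayed Linnik's theorem for every modulus; the class `1` at the
moduli `2^s` is now a theorem (`PrimesInAPGallagher.exists_two_primes_one_mod_two_pow`: primes `q ≡ 1 (mod 2^s)`,
`q ≤ 2^{As}`), so the displayed hypothesis can be dropped.  (The uniform law itself is census-false at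
`p = 786433`, TRIAGE-r1-1 v4; recorded for the bookkeeping of p107816.) [cite: Gallagher1970, Theorem 7] -/
theorem prothDepthFamily_of_prothDepthLaw_unconditional (hD : ProthDepthLaw) : ProthDepthFamily := by
  obtain ⟨A, s₁, -, hsup⟩ :=
    Literature.NumberTheory.Sieve.PrimesInAPGallagher.exists_two_primes_one_mod_two_pow
  obtain ⟨c, hc⟩ := hD
  refine ⟨c, A, fun s₀ => ?_⟩
  set s : ℕ := max s₀ (max s₁ 5) with hs
  have hs5 : 5 ≤ s := (le_max_right _ _).trans (le_max_right _ _)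
  have hs₁ : s₁ ≤ s := (le_max_left _ _).trans (le_max_right _ _)
  obtain ⟨q₁, _, -, hq₁, -, hd₁, -, hq₁A, -⟩ := hsup s hs₁
  exact ⟨s, q₁, le_max_left _ _, hq₁, hd₁, hq₁A, fun N hN => hc q₁ s hq₁ hs5 hd₁ N hN⟩

/-- **`EisensteinQuarantine` is false under the uniform Proth–Legendre depth law ALONE** (no Linnik hypothesis;
cf. `EisensteinQuarantine_false_of_ProthDepthLaw`, p107816). [cite: Gallagher1970, Theorem 7] -/
theorem EisensteinQuarantine_false_of_ProthDepthLaw_unconditional (hD : ProthDepthLaw) :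
    ¬ Summit.ABC.ABC.Theses.DefiniteXi.EisensteinQuarantine :=
  EisensteinQuarantine_false_of_ProthDepthFamily (prothDepthFamily_of_prothDepthLaw_unconditional hD)

/-! ## Re-wiring through the route items (lead c5, 2026-08-17)

Since the route-choice repair b6fe27e7 the multiplicity-one debt displayed above as the named fact
`takahashi2001_brandtEigenLattice_rank_one` is the route ITEM `Summit.ABC.ABC.Theses.DefiniteXi.BrandtEigenLatticeRankOne`
(stmt-ABC-17203, crux r8; same body, definitionally).  The conditional refutation is re-stated with the two route items
`BrandtEigenLatticeRankOne` (stmt-ABC-17203) and `FreyModularity` (stmt-ABC-11340) as its only displayed hypotheses besides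
the research statement `ForcedPairOccurrence` — the exact content of the rev-4 line skeleton
`Cruxes/EisensteinQuarantine/Lines/forced_pair_dlog.lean` (stubs `stub_brandtEigenLatticeRankOne`, `stub_freyModularity`,
`stub_forcedPairOccurrence`; supply proved), so that "stmt-ABC-15023 is refuted the day stmt-ABC-17203, stmt-ABC-11340 and a
proof of the forced-pair occurrence land" is one kernel-checked theorem. -/

/-- **The two route items + the forced-pair occurrence ⟹ `ProthDepthFamily`.**  As
`prothDepthFamily_of_forcedPairOccurrence`, with the eigen-line taken from the route items `BrandtEigenLatticeRankOne`
(stmt-ABC-17203) and `FreyModularity` (stmt-ABC-11340) through the landed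
`freyEigenLinePrime_of_rankOne_of_freyModularity` (p132391; the item's body is DEFINITIONALLY the named fact that
theorem displays, so it applies to `hR` as is); the prime supply is the Literature theorem
`exists_primes_two_pow_mul_dvd_sub_one` (p132885). [cite: Takahashi2001, §2 p. 78] -/
theorem prothDepthFamily_of_items_of_forcedPairOccurrence
    (hR : Summit.ABC.ABC.Theses.DefiniteXi.BrandtEigenLatticeRankOne)
    (hM : Summit.ABC.ABC.Theses.DefiniteXi.FreyModularity) (hO : ForcedPairOccurrence) :
    ProthDepthFamily :=
  prothDepthFamily_of_forcedPairDepthLaw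
    Literature.NumberTheory.Sieve.PrimesInAPGallagher.exists_primes_two_pow_mul_dvd_sub_one
    (forcedPairDepthLaw_of_occurrence
      (Summit.ABC.ABC.Theorems.freyEigenLinePrime_of_rankOne_of_freyModularity hR hM) hO)

/-- **`EisensteinQuarantine` (stmt-ABC-15023) is false under the route items `BrandtEigenLatticeRankOne`
(stmt-ABC-17203) and `FreyModularity` (stmt-ABC-11340) and the forced-pair occurrence** — the rev-4 line
`forced-pair-dlog` as one implication: both displayed items are theorems in print (Eichler/Jacquet–Langlands + strong
multiplicity one; Wiles/BCDT), the prime supply is a theorem of the tree, `ForcedPairOccurrence` is the one arithmetic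
input nobody has proved (research: a 2-adic depth lower bound at `p = 2`, composite squarefree level).  Via p107816.
[cite: Mazur1977, II.16.6 and II.18.10] -/
theorem EisensteinQuarantine_false_of_items_of_forcedPairOccurrence
    (hR : Summit.ABC.ABC.Theses.DefiniteXi.BrandtEigenLatticeRankOne)
    (hM : Summit.ABC.ABC.Theses.DefiniteXi.FreyModularity) (hO : ForcedPairOccurrence) :
    ¬ Summit.ABC.ABC.Theses.DefiniteXi.EisensteinQuarantine :=
  EisensteinQuarantine_false_of_ProthDepthFamily (prothDepthFamily_of_items_of_forcedPairOccurrence hR hM hO)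

end Summit.ABC.ABC.Theorems.EisensteinQuarantine.Negative

end
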